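import Summits.QuantumFields.BalabanUV.Beta.SecondOrderSeparationMixed
import Summits.QuantumFields.BalabanUV.Beta.SecondOrderSplitLoc

/-!
# `BalabanUV.Beta.SecondOrderSeparationCalculus` — binder row D1, the W-side (L4) of hR, leaf (W-CLASS-Q ∕ LOC-Q), part 3: THE CALCULUS OF
# SEPARATION-DECAYING FAMILIES and the pieces of the END's residual — sums, swaps, conjugation by a decaying kernel, the Lagrangian-chart vertex
# over a vertex family of weight kernels (`dM Ξ_c … b`), the dressed diagonal symbols (`X2s`), the sandwiched contact kernel `Ξ_c` itself
# (β sub-cell, D1 formalisation swarm seat `b2b-balaban-beta-d1-formalise-leaf-05`, gen 5; row HR-W-CLASS-Q of LEAVES v10.3, typer-g4 l.11945)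

HONEST FRAMING (cell contract, verbatim): «discharging `BetaPertH` makes Bałaban's UV stability UNCONDITIONAL — a real
constructive-QFT result; it is NOT the continuum limit and NOT the Clay problem.»  HONEST DEPENDENCY (verbatim): «continuum YM on T⁴ ⇐
BetaPertH ∧ nine spine estimates (0/9 proved); BetaPertH ⇐ (D1) ∧ (D4) ∧ CAP+tail; G-an2-4 gates asym, D1 and NE2/3/4.»  [folklore]
analysis bookkeeping; no statement of Bałaban's papers, no `[cite:]` tag, no `def`, no `Prop` fact; instantiates NO binder of the β-function
wall; NOT D1, NOT `BetaPertH`, NOT continuum, NOT Clay.  ABSOLUTE RULE (cell, verbatim): «No internally-minted statement may enter as a cited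
fact. Every hypothesis is either kernel-proved in this package or a verbatim quotation of a PUBLISHED theorem with page reference. The
manuscript(s) under audit are NOT citable for their own disputed steps — they are the thing under adjudication; programme-internal
(2001/route/tribunal) claims are never citable.»  Nothing is cited here.

## The shape (no `def`): a bond-pair family `P μ y ν y′` is SEPARATION-LOCALISED at blocking `N` with data `(C, δ)` when
`∀ μ y ν y′, BiLoc (P μ y ν y′) (N•y) (N•y) (C·e^{−δ·l1 (N•y − N•y′)}) δ` — both legs at the dilated FIRST bond, constant decaying in the separation.
All conclusions below are `∃ C δ, 0 < δ ∧ (that)`.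

* §1 combinators: `sep_of_le` (weaken), `sep_add`, `sep_neg`, `sep_smul`, `sep_swap` (the swapped family `P ν y′ μ y`, re-centred by part 2's
  `biLoc_recenter_same`), `sep_conjV` (conjugation `conjV 𝕄 (P …)` by a decaying `𝕄`), `sep_symRem` (the END's remainder shape
  `½•conjV 𝕄 (Q c b − Q b c) + ½•(P b c + P c b)`).
* §2 pieces over a VERTEX FAMILY of weight kernels `A ν y′` (bi-localised at `(N•y′, N•y′)`): `sep_dM_of_vertexFamily` (`dM (A c) N S M b`),
  `sep_vertexOfK_diag_of_vertexFamily` (`vertexOfK (A c) N (diagK ∘ g) b`); and the slot pieces of parts 1–2 packaged: `sep_vertex2OfK`,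
  `sep_mixOfK`, `sep_mixOfK_swap`.
* §3 the contact kernel: `vertexFamily_dressedGen` (the dressed diagonal symbol `Σ colH K N ν y′ · g` at `(N•y′, N•y′)`), `vertexFamily_conjV`,
  **`vertexFamily_Xi`** (`Ξ_c := −(K ∘ conjV 𝕄 (dressed symbol at c) ∘ K)` is a vertex family), `vertexFamily_K2OfK_add_Xi`.
Provenance: b2b-balaban β sub-cell, D1 formalisation swarm leaf-05 gen 5, 2026-08-20 (v1); no existing file touched.
-/

noncomputable section

open Finset
open scoped BigOperators
open Literature.MathematicalPhysics.QuantumFieldTheory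
open Literature.MathematicalPhysics.QuantumFieldTheory.Balaban1983to89
open Literature.MathematicalPhysics.QuantumFieldTheory.Balaban1983to89.Beta
open B12Sec2to5 (l1 l1_nonneg)
open ExpKernelCalculus (MKer Site Decays BiLoc VertexFamily comp Zl Zl_nonneg l1_sub_symm biLoc_comp_decays)
open KernelWard (biLoc_add biLoc_sub)
open OneStepResolventKernel (Fib LocStencil decays_mono biLoc_mono)
open OneStepKernelFamily (colH vertexOfK vertexFamily_vertexOfK)
open BalabanStepJetsSucc (biLoc_comp_right)
open BalabanCompositeJets (LocStencil₂)
open BalabanStepW2 (biLoc_le_mono)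
open SecondOrderResponse (dM K2OfK vertex2OfK mixOfK LocStencilFM biLoc_neg biLoc_smul biLoc_sandwich biLoc_vertexOfK_of_biLoc
  biLoc_vertexOfM_of_biLoc vertexFamily_K2OfK)
open Summit.QuantumFields.BalabanUV.Beta.TameKernelCalculus
open Summit.QuantumFields.BalabanUV.Beta.ChartConjugation (conjV)
open Summit.QuantumFields.BalabanUV.Beta.BorderedHessian (diagK)
open Summit.QuantumFields.BalabanUV.Beta.SecondOrderSplitDecay (diagK_dressed_eq_vertexOfK)
open Summit.QuantumFields.BalabanUV.Beta.SecondOrderSeparation (biLoc_vertex2OfK_sep)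
open Summit.QuantumFields.BalabanUV.Beta.SecondOrderSeparationMixed (biLoc_mixOfK_sep biLoc_mixOfK_swap_sep biLoc_recenter_same)

namespace Summit.QuantumFields.BalabanUV.Beta.SecondOrderSeparationCalculus

variable {d N : ℕ}

/-! ## §1 Combinators for separation-localised bond-pair families -/

section Combinators

variable {P Q : Fin (d + 1) → (Fin (d + 1) → ℤ) → Fin (d + 1) → (Fin (d + 1) → ℤ) → MKer (d + 1) (Fib d)}

/-- [folklore] Weaken a separation-localised bound: smaller rate (both in the kernel and in the separation decay), larger constant. -/
theorem sep_of_le {C δ δ' : ℝ} (h : ∀ μ y ν y', BiLoc (P μ y ν y') ((N : ℤ) • y) ((N : ℤ) • y) (C * Real.exp (-δ * l1 ((N : ℤ) • y - (N : ℤ) • y'))) δ)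
    (hC : 0 ≤ C) (hle : δ' ≤ δ) (μ : Fin (d + 1)) (y : Fin (d + 1) → ℤ) (ν : Fin (d + 1)) (y' : Fin (d + 1) → ℤ) :
    BiLoc (P μ y ν y') ((N : ℤ) • y) ((N : ℤ) • y) (C * Real.exp (-δ' * l1 ((N : ℤ) • y - (N : ℤ) • y'))) δ' :=
  biLoc_le_mono (h μ y ν y') (by positivity)
    (mul_le_mul_of_nonneg_left (Real.exp_le_exp.2 (by nlinarith [l1_nonneg ((N : ℤ) • y - (N : ℤ) • y')])) hC) hle

/-- [folklore] **SUM** of two separation-localised families. -/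
theorem sep_add (hP : ∃ C δ : ℝ, 0 < δ ∧ ∀ μ y ν y', BiLoc (P μ y ν y') ((N : ℤ) • y) ((N : ℤ) • y) (C * Real.exp (-δ * l1 ((N : ℤ) • y - (N : ℤ) • y'))) δ)
    (hQ : ∃ C δ : ℝ, 0 < δ ∧ ∀ μ y ν y', BiLoc (Q μ y ν y') ((N : ℤ) • y) ((N : ℤ) • y) (C * Real.exp (-δ * l1 ((N : ℤ) • y - (N : ℤ) • y'))) δ) :
    ∃ C δ : ℝ, 0 < δ ∧ ∀ μ y ν y', BiLoc (P μ y ν y' + Q μ y ν y') ((N : ℤ) • y) ((N : ℤ) • y)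
      (C * Real.exp (-δ * l1 ((N : ℤ) • y - (N : ℤ) • y'))) δ := by
  obtain ⟨C₁, δ₁, hδ₁, h₁⟩ := hP
  obtain ⟨C₂, δ₂, hδ₂, h₂⟩ := hQ
  have hC₁ : 0 ≤ C₁ := by
    have := (h₁ 0 0 0 0).nonneg (Sum.inl 0); simp [l1] at this; exact this
  have hC₂ : 0 ≤ C₂ := by
    have := (h₂ 0 0 0 0).nonneg (Sum.inl 0); simp [l1] at this; exact this
  refine ⟨C₁ + C₂, min δ₁ δ₂, lt_min hδ₁ hδ₂, fun μ y ν y' => ?_⟩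
  rw [add_mul]
  exact biLoc_add (sep_of_le h₁ hC₁ (min_le_left _ _) μ y ν y') (sep_of_le h₂ hC₂ (min_le_right _ _) μ y ν y')

/-- [folklore] **NEGATION**. -/
theorem sep_neg (hP : ∃ C δ : ℝ, 0 < δ ∧ ∀ μ y ν y', BiLoc (P μ y ν y') ((N : ℤ) • y) ((N : ℤ) • y) (C * Real.exp (-δ * l1 ((N : ℤ) • y - (N : ℤ) • y'))) δ) :
    ∃ C δ : ℝ, 0 < δ ∧ ∀ μ y ν y', BiLoc (-P μ y ν y') ((N : ℤ) • y) ((N : ℤ) • y) (C * Real.exp (-δ * l1 ((N : ℤ) • y - (N : ℤ) • y'))) δ := by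
  obtain ⟨C, δ, hδ, h⟩ := hP
  exact ⟨C, δ, hδ, fun μ y ν y' => biLoc_neg (h μ y ν y')⟩

/-- [folklore] **SCALAR MULTIPLE**. -/
theorem sep_smul (c : ℝ)
    (hP : ∃ C δ : ℝ, 0 < δ ∧ ∀ μ y ν y', BiLoc (P μ y ν y') ((N : ℤ) • y) ((N : ℤ) • y) (C * Real.exp (-δ * l1 ((N : ℤ) • y - (N : ℤ) • y'))) δ) :
    ∃ C δ : ℝ, 0 < δ ∧ ∀ μ y ν y', BiLoc (c • P μ y ν y') ((N : ℤ) • y) ((N : ℤ) • y) (C * Real.exp (-δ * l1 ((N : ℤ) • y - (N : ℤ) • y'))) δ := by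
  obtain ⟨C, δ, hδ, h⟩ := hP
  refine ⟨|c| * C, δ, hδ, fun μ y ν y' => ?_⟩
  rw [mul_assoc]
  exact biLoc_smul c (h μ y ν y')

/-- [folklore] **SWAP OF THE TWO BONDS**: if `P` is separation-localised then so is `(μ, y, ν, y′) ↦ P ν y′ μ y` — the swapped member is
localised at `(N•y′, N•y′)` with a constant decaying in the SAME separation, and part 2's `biLoc_recenter_same` moves both legs to `(N•y, N•y)`
at the cost of two thirds of that decay (rate `δ/3`). -/
theorem sep_swap (hP : ∃ C δ : ℝ, 0 < δ ∧ ∀ μ y ν y', BiLoc (P μ y ν y') ((N : ℤ) • y) ((N : ℤ) • y) (C * Real.exp (-δ * l1 ((N : ℤ) • y - (N : ℤ) • y'))) δ) :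
    ∃ C δ : ℝ, 0 < δ ∧ ∀ μ y ν y', BiLoc (P ν y' μ y) ((N : ℤ) • y) ((N : ℤ) • y) (C * Real.exp (-δ * l1 ((N : ℤ) • y - (N : ℤ) • y'))) δ := by
  obtain ⟨C, δ, hδ, h⟩ := hP
  have hC : 0 ≤ C := by
    have := (h 0 0 0 0).nonneg (Sum.inl 0); simp [l1] at this; exact this
  refine ⟨C, δ / 3, by positivity, fun μ y ν y' => ?_⟩
  have h1 : BiLoc (P ν y' μ y) ((N : ℤ) • y') ((N : ℤ) • y') (C * Real.exp (-(3 * (δ / 3)) * l1 ((N : ℤ) • y - (N : ℤ) • y'))) (δ / 3) := by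
    have h0 := h ν y' μ y
    rw [l1_sub_symm] at h0
    rw [show 3 * (δ / 3) = δ by ring]
    exact biLoc_mono h0 (by positivity) (by linarith)
  exact biLoc_recenter_same h1 hC (by positivity)

/-- [folklore] **CONJUGATION BY A DECAYING KERNEL**: `𝕄` decaying at some rate ⇒ `(b, c) ↦ conjV 𝕄 (P b c) = 𝕄∘P − P∘𝕄` is separation-localised
when `P` is (Literature `biLoc_comp_decays` ∕ `biLoc_comp_right` at a common rate). -/
theorem sep_conjV {𝕄 : MKer (d + 1) (Fib d)} (h𝕄 : ∃ δ C : ℝ, 0 < δ ∧ 0 ≤ C ∧ Decays 𝕄 C δ)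
    (hP : ∃ C δ : ℝ, 0 < δ ∧ ∀ μ y ν y', BiLoc (P μ y ν y') ((N : ℤ) • y) ((N : ℤ) • y) (C * Real.exp (-δ * l1 ((N : ℤ) • y - (N : ℤ) • y'))) δ) :
    ∃ C δ : ℝ, 0 < δ ∧ ∀ μ y ν y', BiLoc (conjV 𝕄 (P μ y ν y')) ((N : ℤ) • y) ((N : ℤ) • y) (C * Real.exp (-δ * l1 ((N : ℤ) • y - (N : ℤ) • y'))) δ := by
  obtain ⟨δ𝕄, C𝕄, hδ𝕄, hC𝕄, h𝕄d⟩ := h𝕄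
  obtain ⟨C, δ, hδ, h⟩ := hP
  have hC : 0 ≤ C := by
    have := (h 0 0 0 0).nonneg (Sum.inl 0); simp [l1] at this; exact this
  set m : ℝ := min δ𝕄 δ with hm_def
  have hm : 0 < m := lt_min hδ𝕄 hδ
  have h𝕄m : Decays 𝕄 C𝕄 m := decays_mono h𝕄d hC𝕄 le_rfl (min_le_left _ _)
  have hZ : 0 ≤ Zl (d + 1) (m - m / 2) := Zl_nonneg (by rw [show m - m / 2 = m / 2 by ring]; positivity)
  refine ⟨(Fintype.card (Fib d) : ℝ) * (C𝕄 * C) * Zl (d + 1) (m - m / 2) + (Fintype.card (Fib d) : ℝ) * (C * C𝕄) * Zl (d + 1) (m - m / 2),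
    m / 2, half_pos hm, fun μ y ν y' => ?_⟩
  have hmδ : m / 2 ≤ δ := (half_le_self hm.le).trans (min_le_right _ _)
  have hexp : Real.exp (-δ * l1 ((N : ℤ) • y - (N : ℤ) • y')) ≤ Real.exp (-(m / 2) * l1 ((N : ℤ) • y - (N : ℤ) • y')) :=
    Real.exp_le_exp.2 (by nlinarith [l1_nonneg ((N : ℤ) • y - (N : ℤ) • y')])
  have hPm : BiLoc (P μ y ν y') ((N : ℤ) • y) ((N : ℤ) • y) (C * Real.exp (-(m / 2) * l1 ((N : ℤ) • y - (N : ℤ) • y'))) m :=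
    biLoc_le_mono (h μ y ν y') (by positivity) (mul_le_mul_of_nonneg_left hexp hC) (min_le_right _ _)
  have e1 := biLoc_comp_decays h𝕄m hPm (half_pos hm).le (half_lt_self hm)
  have e2 := biLoc_comp_right hPm h𝕄m (half_pos hm).le (half_lt_self hm)
  unfold ChartConjugation.conjV
  refine biLoc_le_mono (biLoc_sub e1 e2) (by positivity) (le_of_eq ?_) le_rfl
  ring

/-- [folklore] **THE END's SYMMETRISED REMAINDER SHAPE** `½•conjV 𝕄 (Q c b − Q b c) + ½•(P b c + P c b)` is separation-localised when `P`, `Q` are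
and `𝕄` decays. -/
theorem sep_symRem {𝕄 : MKer (d + 1) (Fib d)} (h𝕄 : ∃ δ C : ℝ, 0 < δ ∧ 0 ≤ C ∧ Decays 𝕄 C δ)
    (hP : ∃ C δ : ℝ, 0 < δ ∧ ∀ μ y ν y', BiLoc (P μ y ν y') ((N : ℤ) • y) ((N : ℤ) • y) (C * Real.exp (-δ * l1 ((N : ℤ) • y - (N : ℤ) • y'))) δ)
    (hQ : ∃ C δ : ℝ, 0 < δ ∧ ∀ μ y ν y', BiLoc (Q μ y ν y') ((N : ℤ) • y) ((N : ℤ) • y) (C * Real.exp (-δ * l1 ((N : ℤ) • y - (N : ℤ) • y'))) δ) :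
    ∃ C δ : ℝ, 0 < δ ∧ ∀ μ y ν y', BiLoc ((1 / 2 : ℝ) • conjV 𝕄 (Q ν y' μ y - Q μ y ν y') + (1 / 2 : ℝ) • (P μ y ν y' + P ν y' μ y))
      ((N : ℤ) • y) ((N : ℤ) • y) (C * Real.exp (-δ * l1 ((N : ℤ) • y - (N : ℤ) • y'))) δ := by
  have hQd : ∃ C δ : ℝ, 0 < δ ∧ ∀ μ y ν y', BiLoc (Q ν y' μ y - Q μ y ν y') ((N : ℤ) • y) ((N : ℤ) • y)
      (C * Real.exp (-δ * l1 ((N : ℤ) • y - (N : ℤ) • y'))) δ := by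
    have h := sep_add (sep_swap hQ) (sep_neg hQ)
    simpa only [sub_eq_add_neg] using h
  exact sep_add (sep_smul _ (sep_conjV h𝕄 hQd)) (sep_smul _ (sep_add hP (sep_swap hP)))

end Combinators

/-! ## §2 Pieces over a vertex family of weight kernels; the slot pieces packaged -/

section Pieces

/-- [folklore] **THE LAGRANGIAN-CHART VERTEX OVER A VERTEX FAMILY OF WEIGHT KERNELS IS SEPARATION-LOCALISED**: `A ν y′` bi-localised at
`(N•y′, N•y′)` (a `VertexFamily`), `S` a local stencil family, `M` a vertex family ⇒ `(b, c) ↦ dM (A c) N S M b` is separation-localised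
(Literature `biLoc_vertexOfK_of_biLoc`∕`biLoc_vertexOfM_of_biLoc` at the centre `N•y′`, then re-centred to `N•y`). -/
theorem sep_dM_of_vertexFamily [NeZero N] {A : Fin (d + 1) → (Fin (d + 1) → ℤ) → MKer (d + 1) (Fib d)} (hA : ∃ CA δA : ℝ, 0 < δA ∧ VertexFamily A N CA δA)
    {S : Fin (d + 1) → (Fin (d + 1) → ℤ) → MKer (d + 1) (Fib d)} (hS : ∃ Cs δs : ℝ, 0 < δs ∧ LocStencil S Cs δs)
    {M : Fin (d + 1) → (Fin (d + 1) → ℤ) → MKer (d + 1) (Fib d)} (hM : ∃ CM δM : ℝ, 0 < δM ∧ VertexFamily M N CM δM) :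
    ∃ C δ : ℝ, 0 < δ ∧ ∀ μ y ν y', BiLoc (dM (A ν y') N S M μ y) ((N : ℤ) • y) ((N : ℤ) • y) (C * Real.exp (-δ * l1 ((N : ℤ) • y - (N : ℤ) • y'))) δ := by
  obtain ⟨CA, δA, hδA, hA⟩ := hA
  obtain ⟨Cs, δs, hδs, hS⟩ := hS
  obtain ⟨CM, δM, hδM, hM⟩ := hM
  have hCA : 0 ≤ CA := (hA 0 0).nonneg (Sum.inl 0)
  have hCs : 0 ≤ Cs := (hS 0 0).nonneg (Sum.inl 0)
  have hCM : 0 ≤ CM := (hM 0 0).nonneg (Sum.inl 0)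
  set m : ℝ := min δA (min δs δM) with hm_def
  have hm : 0 < m := lt_min hδA (lt_min hδs hδM)
  have hAm : ∀ ν y', BiLoc (A ν y') ((N : ℤ) • y') ((N : ℤ) • y') CA m := fun ν y' => biLoc_mono (hA ν y') hCA (min_le_left _ _)
  have hSm : LocStencil S Cs m := fun κ u => biLoc_mono (hS κ u) hCs ((min_le_right _ _).trans (min_le_left _ _))
  have hMm : VertexFamily M N CM m := fun ρ w => biLoc_mono (hM ρ w) hCM ((min_le_right _ _).trans (min_le_right _ _))
  -- apply at (N•y', N•y'): constant decays in |N•y − N•y'|; then re-centre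
  set B : ℝ := (d + 1 : ℕ) * (CA * Cs * Zl (d + 1) (m / 2)) + (d + 1 : ℕ) * (CA * CM * Zl (d + 1) (m / 2)) with hB_def
  have hZ : 0 ≤ Zl (d + 1) (m / 2) := Zl_nonneg (half_pos hm)
  have hB : 0 ≤ B := by positivity
  refine ⟨B, m / 6, by positivity, fun μ y ν y' => ?_⟩
  have h1 := biLoc_vertexOfK_of_biLoc (N := N) (hAm ν y') hSm hm μ y
  have h2 := biLoc_vertexOfM_of_biLoc (N := N) (hAm ν y') hMm hm μ y
  have h3 : BiLoc (dM (A ν y') N S M μ y) ((N : ℤ) • y') ((N : ℤ) • y')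
      (B * Real.exp (-m * l1 ((N : ℤ) • y - (N : ℤ) • y'))) (m / 2) := by
    unfold SecondOrderResponse.dM
    refine biLoc_le_mono (biLoc_add h1 h2) (by positivity) (le_of_eq ?_) le_rfl
    rw [hB_def]; ring
  have h4 : BiLoc (dM (A ν y') N S M μ y) ((N : ℤ) • y') ((N : ℤ) • y')
      (B * Real.exp (-(3 * (m / 6)) * l1 ((N : ℤ) • y - (N : ℤ) • y'))) (m / 6) := by
    refine biLoc_le_mono h3 (by positivity) ?_ (by linarith)
    exact mul_le_mul_of_nonneg_left (Real.exp_le_exp.2 (by nlinarith [l1_nonneg ((N : ℤ) • y - (N : ℤ) • y')])) hB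
  exact biLoc_recenter_same h4 hB (by positivity)

/-- [folklore] **THE DIAGONAL-TABLE VERTEX OVER A VERTEX FAMILY OF WEIGHT KERNELS IS SEPARATION-LOCALISED**: `(b, c) ↦ vertexOfK (A c) N (diagK ∘ g) b`
(the dressed diagonal symbol of the END's second symbol, read through the kernels `A c = K2OfK … c + Ξ_c`). -/
theorem sep_vertexOfK_diag_of_vertexFamily {A : Fin (d + 1) → (Fin (d + 1) → ℤ) → MKer (d + 1) (Fib d)}
    (hA : ∃ CA δA : ℝ, 0 < δA ∧ VertexFamily A N CA δA)
    {g : Fin (d + 1) → (Fin (d + 1) → ℤ) → (Fin (d + 1) → ℤ) → Fib d → ℝ} (hgl : ∃ Cg δg : ℝ, 0 < δg ∧ LocStencil (fun κ u => diagK (g κ u)) Cg δg) :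
    ∃ C δ : ℝ, 0 < δ ∧ ∀ μ y ν y', BiLoc (vertexOfK (A ν y') N (fun κ u => diagK (g κ u)) μ y) ((N : ℤ) • y) ((N : ℤ) • y)
      (C * Real.exp (-δ * l1 ((N : ℤ) • y - (N : ℤ) • y'))) δ := by
  obtain ⟨CA, δA, hδA, hA⟩ := hA
  obtain ⟨Cg, δg, hδg, hg⟩ := hgl
  have hCA : 0 ≤ CA := (hA 0 0).nonneg (Sum.inl 0)
  have hCg : 0 ≤ Cg := (hg 0 0).nonneg (Sum.inl 0)
  set m : ℝ := min δA δg with hm_def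
  have hm : 0 < m := lt_min hδA hδg
  have hAm : ∀ ν y', BiLoc (A ν y') ((N : ℤ) • y') ((N : ℤ) • y') CA m := fun ν y' => biLoc_mono (hA ν y') hCA (min_le_left _ _)
  have hgm : LocStencil (fun κ u => diagK (g κ u)) Cg m := fun κ u => biLoc_mono (hg κ u) hCg (min_le_right _ _)
  set B : ℝ := (d + 1 : ℕ) * (CA * Cg * Zl (d + 1) (m / 2)) with hB_def
  have hZ : 0 ≤ Zl (d + 1) (m / 2) := Zl_nonneg (half_pos hm)
  have hB : 0 ≤ B := by positivity
  refine ⟨B, m / 6, by positivity, fun μ y ν y' => ?_⟩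
  have h1 := biLoc_vertexOfK_of_biLoc (N := N) (hAm ν y') hgm hm μ y
  have h3 : BiLoc (vertexOfK (A ν y') N (fun κ u => diagK (g κ u)) μ y) ((N : ℤ) • y') ((N : ℤ) • y')
      (B * Real.exp (-(3 * (m / 6)) * l1 ((N : ℤ) • y - (N : ℤ) • y'))) (m / 6) := by
    refine biLoc_le_mono h1 (by positivity) ?_ (by linarith)
    calc (d + 1 : ℕ) * (CA * Real.exp (-m * l1 ((N : ℤ) • y - (N : ℤ) • y')) * Cg * Zl (d + 1) (m / 2))
        = B * Real.exp (-m * l1 ((N : ℤ) • y - (N : ℤ) • y')) := by rw [hB_def]; ring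
      _ ≤ B * Real.exp (-(3 * (m / 6)) * l1 ((N : ℤ) • y - (N : ℤ) • y')) :=
          mul_le_mul_of_nonneg_left (Real.exp_le_exp.2 (by nlinarith [l1_nonneg ((N : ℤ) • y - (N : ℤ) • y')])) hB
  exact biLoc_recenter_same h3 hB (by positivity)

variable {K : MKer (d + 1) (Fib d)}

/-- [folklore] Part 1's `biLoc_vertex2OfK_sep`, packaged: the bi-vertex of a `LocStencil₂` family is separation-localised. -/
theorem sep_vertex2OfK (hK : ∃ δ C : ℝ, 0 < δ ∧ 0 ≤ C ∧ Decays K C δ)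
    {R₂ : Fin (d + 1) → (Fin (d + 1) → ℤ) → Fin (d + 1) → (Fin (d + 1) → ℤ) → MKer (d + 1) (Fib d)} (hR₂ : ∃ C₂ δ₂ : ℝ, 0 < δ₂ ∧ LocStencil₂ R₂ C₂ δ₂) :
    ∃ C δ : ℝ, 0 < δ ∧ ∀ μ y ν y', BiLoc (vertex2OfK K N R₂ μ y ν y') ((N : ℤ) • y) ((N : ℤ) • y)
      (C * Real.exp (-δ * l1 ((N : ℤ) • y - (N : ℤ) • y'))) δ := by
  obtain ⟨δK, C, hδK, hC, hKd⟩ := hK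
  obtain ⟨C₂, δ₂, hδ₂, hR⟩ := hR₂
  have hm : 0 < min δK δ₂ := lt_min hδK hδ₂
  have hC₂ : 0 ≤ C₂ := hR.nonneg
  have hZ1 : 0 ≤ Zl (d + 1) (min δK δ₂ / 2) := Zl_nonneg (half_pos hm)
  have hZ2 : 0 ≤ Zl (d + 1) (5 * min δK δ₂ / 8) := Zl_nonneg (by positivity)
  refine ⟨(d + 1 : ℕ) * (C * ((d + 1 : ℕ) * (C * C₂ * Zl (d + 1) (min δK δ₂ / 2))) * Zl (d + 1) (5 * min δK δ₂ / 8)), min δK δ₂ / 4,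
    by positivity, fun μ y ν y' => ?_⟩
  have h1 := biLoc_vertex2OfK_sep (N := N) (decays_mono hKd hC le_rfl (min_le_left δK δ₂)) hm (hR.mono (min_le_right δK δ₂)) μ y ν y'
  rw [← mul_assoc] at h1
  exact biLoc_le_mono h1 (by positivity) le_rfl (by linarith)

/-- [folklore] Part 2's `biLoc_mixOfK_sep`, packaged. -/
theorem sep_mixOfK [NeZero N] (hK : ∃ δ C : ℝ, 0 < δ ∧ 0 ≤ C ∧ Decays K C δ)
    {RM : Fin (d + 1) → (Fin (d + 1) → ℤ) → Fin (d + 1) → (Fin (d + 1) → ℤ) → MKer (d + 1) (Fib d)} (hRM : ∃ CM δM : ℝ, 0 < δM ∧ LocStencilFM N RM CM δM) :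
    ∃ C δ : ℝ, 0 < δ ∧ ∀ μ y ν y', BiLoc (mixOfK K N RM μ y ν y') ((N : ℤ) • y) ((N : ℤ) • y)
      (C * Real.exp (-δ * l1 ((N : ℤ) • y - (N : ℤ) • y'))) δ := by
  obtain ⟨δK, C, hδK, hC, hKd⟩ := hK
  obtain ⟨CM, δM, hδM, hR⟩ := hRM
  have hm : 0 < min δK δM := lt_min hδK hδM
  have hCM : 0 ≤ CM := hR.nonneg
  have hZ1 : 0 ≤ Zl (d + 1) (min δK δM / 2) := Zl_nonneg (half_pos hm)
  have hZ2 : 0 ≤ Zl (d + 1) (5 * min δK δM / 8) := Zl_nonneg (by positivity)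
  refine ⟨(d + 1 : ℕ) * (C * ((d + 1 : ℕ) * (C * CM * Zl (d + 1) (min δK δM / 2))) * Zl (d + 1) (5 * min δK δM / 8)), min δK δM / 4,
    by positivity, fun μ y ν y' => ?_⟩
  have h1 := biLoc_mixOfK_sep (N := N) (decays_mono hKd hC le_rfl (min_le_left δK δM)) hm (hR.mono (min_le_right δK δM)) μ y ν y'
  rw [← mul_assoc] at h1
  exact biLoc_le_mono h1 (by positivity) le_rfl (by linarith)

/-- [folklore] Part 2's `biLoc_mixOfK_swap_sep`, packaged: the swapped mixed bi-vertex. -/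
theorem sep_mixOfK_swap [NeZero N] (hK : ∃ δ C : ℝ, 0 < δ ∧ 0 ≤ C ∧ Decays K C δ)
    {RM : Fin (d + 1) → (Fin (d + 1) → ℤ) → Fin (d + 1) → (Fin (d + 1) → ℤ) → MKer (d + 1) (Fib d)} (hRM : ∃ CM δM : ℝ, 0 < δM ∧ LocStencilFM N RM CM δM) :
    ∃ C δ : ℝ, 0 < δ ∧ ∀ μ y ν y', BiLoc (mixOfK K N RM ν y' μ y) ((N : ℤ) • y) ((N : ℤ) • y)
      (C * Real.exp (-δ * l1 ((N : ℤ) • y - (N : ℤ) • y'))) δ :=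
  sep_swap (sep_mixOfK hK hRM)

end Pieces

/-! ## §3 The contact kernel `Ξ_c` is a vertex family -/

section Xi

variable {K 𝕄 : MKer (d + 1) (Fib d)}

/-- [folklore] **THE DRESSED DIAGONAL SYMBOL IS A VERTEX FAMILY**: `diagK (Σ_κ Σ'_u colH K N ν y′ κ u · g κ u)` is bi-localised at `(N•y′, N•y′)`
(leaf-10's `diagK_dressed_eq_vertexOfK` + Literature `vertexFamily_vertexOfK`). -/
theorem vertexFamily_dressedGen (hK : ∃ δ C : ℝ, 0 < δ ∧ 0 ≤ C ∧ Decays K C δ)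
    {g : Fin (d + 1) → (Fin (d + 1) → ℤ) → (Fin (d + 1) → ℤ) → Fib d → ℝ} (hgl : ∃ Cg δg : ℝ, 0 < δg ∧ LocStencil (fun κ u => diagK (g κ u)) Cg δg) :
    ∃ C δ : ℝ, 0 < δ ∧ VertexFamily (fun ν y' => diagK fun p c => ∑ κ, ∑' u, colH K N ν y' κ u * g κ u p c) N C δ := by
  obtain ⟨Cg, δg, hδg, hg⟩ := hgl
  obtain ⟨Cv, δv, hδv, hV⟩ := OneStepKernelFamily.vertexFamily_vertexOfK' (N := N) hK hg hδg
  refine ⟨Cv, δv, hδv, fun ν y' => ?_⟩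
  show BiLoc (diagK fun p c => ∑ κ, ∑' u, colH K N ν y' κ u * g κ u p c) _ _ _ _
  rw [diagK_dressed_eq_vertexOfK]
  exact hV ν y'

/-- [folklore] Conjugation by a decaying kernel preserves vertex families. -/
theorem vertexFamily_conjV (h𝕄 : ∃ δ C : ℝ, 0 < δ ∧ 0 ≤ C ∧ Decays 𝕄 C δ) {X : Fin (d + 1) → (Fin (d + 1) → ℤ) → MKer (d + 1) (Fib d)}
    (hX : ∃ C δ : ℝ, 0 < δ ∧ VertexFamily X N C δ) : ∃ C δ : ℝ, 0 < δ ∧ VertexFamily (fun ν y' => conjV 𝕄 (X ν y')) N C δ := by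
  obtain ⟨δ𝕄, C𝕄, hδ𝕄, hC𝕄, h𝕄d⟩ := h𝕄
  obtain ⟨CX, δX, hδX, hXv⟩ := hX
  have hCX : 0 ≤ CX := (hXv 0 0).nonneg (Sum.inl 0)
  set m : ℝ := min δ𝕄 δX with hm_def
  have hm : 0 < m := lt_min hδ𝕄 hδX
  have h𝕄m : Decays 𝕄 C𝕄 m := decays_mono h𝕄d hC𝕄 le_rfl (min_le_left _ _)
  have hZ : 0 ≤ Zl (d + 1) (m - m / 2) := Zl_nonneg (by rw [show m - m / 2 = m / 2 by ring]; positivity)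
  refine ⟨(Fintype.card (Fib d) : ℝ) * (C𝕄 * CX) * Zl (d + 1) (m - m / 2) + (Fintype.card (Fib d) : ℝ) * (CX * C𝕄) * Zl (d + 1) (m - m / 2),
    m / 2, half_pos hm, fun ν y' => ?_⟩
  have hXm : BiLoc (X ν y') ((N : ℤ) • y') ((N : ℤ) • y') CX m := biLoc_mono (hXv ν y') hCX (min_le_right _ _)
  have e1 := biLoc_comp_decays h𝕄m hXm (half_pos hm).le (half_lt_self hm)
  have e2 := biLoc_comp_right hXm h𝕄m (half_pos hm).le (half_lt_self hm)
  unfold ChartConjugation.conjV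
  exact biLoc_sub e1 e2

/-- [folklore] The (negative) `K`-sandwich of a vertex family is a vertex family (Literature `biLoc_sandwich`). -/
theorem vertexFamily_negSandwich (hK : ∃ δ C : ℝ, 0 < δ ∧ 0 ≤ C ∧ Decays K C δ) {X : Fin (d + 1) → (Fin (d + 1) → ℤ) → MKer (d + 1) (Fib d)}
    (hX : ∃ C δ : ℝ, 0 < δ ∧ VertexFamily X N C δ) :
    ∃ C δ : ℝ, 0 < δ ∧ VertexFamily (fun ν y' => -(comp (comp K (X ν y')) K)) N C δ := by
  obtain ⟨δK, C, hδK, hC, hKd⟩ := hK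
  obtain ⟨CX, δX, hδX, hXv⟩ := hX
  have hCX : 0 ≤ CX := (hXv 0 0).nonneg (Sum.inl 0)
  set m : ℝ := min δK δX with hm_def
  have hm : 0 < m := lt_min hδK hδX
  refine ⟨(Fintype.card (Fib d) : ℝ) * ((Fintype.card (Fib d) : ℝ) * (C * CX) * Zl (d + 1) (m / 2) * C) * Zl (d + 1) (m / 4), m / 4,
    by positivity, fun ν y' => ?_⟩
  exact biLoc_sandwich (decays_mono hKd hC le_rfl (min_le_left δK δX)) hC hm (biLoc_mono (hXv ν y') hCX (min_le_right δK δX))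

/-- [folklore] **THE CONTACT KERNEL `Ξ_c := −(K ∘ conjV 𝕄 (dressed symbol at c) ∘ K)` IS A VERTEX FAMILY** (decaying `K`, `𝕄`; local diagonal
generator family `g`). -/
theorem vertexFamily_Xi (hK : ∃ δ C : ℝ, 0 < δ ∧ 0 ≤ C ∧ Decays K C δ) (h𝕄 : ∃ δ C : ℝ, 0 < δ ∧ 0 ≤ C ∧ Decays 𝕄 C δ)
    {g : Fin (d + 1) → (Fin (d + 1) → ℤ) → (Fin (d + 1) → ℤ) → Fib d → ℝ} (hgl : ∃ Cg δg : ℝ, 0 < δg ∧ LocStencil (fun κ u => diagK (g κ u)) Cg δg) :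
    ∃ C δ : ℝ, 0 < δ ∧ VertexFamily
      (fun ν y' => -(comp (comp K (conjV 𝕄 (diagK fun p c => ∑ κ, ∑' u, colH K N ν y' κ u * g κ u p c))) K)) N C δ :=
  vertexFamily_negSandwich hK (vertexFamily_conjV h𝕄 (vertexFamily_dressedGen hK hgl))

/-- [folklore] `K2OfK K N S M c + Ξ_c` is a vertex family (Literature `vertexFamily_K2OfK` + `vertexFamily_Xi`). -/
theorem vertexFamily_K2OfK_add_Xi [NeZero N] (hK : ∃ δ C : ℝ, 0 < δ ∧ 0 ≤ C ∧ Decays K C δ) (h𝕄 : ∃ δ C : ℝ, 0 < δ ∧ 0 ≤ C ∧ Decays 𝕄 C δ)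
    {S : Fin (d + 1) → (Fin (d + 1) → ℤ) → MKer (d + 1) (Fib d)} (hS : ∃ Cs δs : ℝ, 0 < δs ∧ LocStencil S Cs δs)
    {M : Fin (d + 1) → (Fin (d + 1) → ℤ) → MKer (d + 1) (Fib d)} (hM : ∃ CM δM : ℝ, 0 < δM ∧ VertexFamily M N CM δM)
    {g : Fin (d + 1) → (Fin (d + 1) → ℤ) → (Fin (d + 1) → ℤ) → Fib d → ℝ} (hgl : ∃ Cg δg : ℝ, 0 < δg ∧ LocStencil (fun κ u => diagK (g κ u)) Cg δg) :
    ∃ C δ : ℝ, 0 < δ ∧ VertexFamily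
      (fun ν y' => K2OfK K N S M ν y' +
        -(comp (comp K (conjV 𝕄 (diagK fun p c => ∑ κ, ∑' u, colH K N ν y' κ u * g κ u p c))) K)) N C δ := by
  obtain ⟨δK, C, hδK, hC, hKd⟩ := hK
  obtain ⟨Cs, δs, hδs, hSl⟩ := hS
  obtain ⟨CM, δM, hδM, hMl⟩ := hM
  obtain ⟨CΞ, δΞ, hδΞ, hΞ⟩ := vertexFamily_Xi (N := N) ⟨δK, C, hδK, hC, hKd⟩ h𝕄 hgl
  have hCs : 0 ≤ Cs := (hSl 0 0).nonneg (Sum.inl 0)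
  have hCM : 0 ≤ CM := (hMl 0 0).nonneg (Sum.inl 0)
  have hCΞ : 0 ≤ CΞ := (hΞ 0 0).nonneg (Sum.inl 0)
  set m : ℝ := min δK (min δs δM) with hm_def
  have hm : 0 < m := lt_min hδK (lt_min hδs hδM)
  have hK2 := vertexFamily_K2OfK (N := N) (decays_mono hKd hC le_rfl (min_le_left _ _)) hC hm
    (S := S) (Cs := Cs) (fun κ u => biLoc_mono (hSl κ u) hCs ((min_le_right _ _).trans (min_le_left _ _)))
    (M := M) (CM := CM) (fun ρ w => biLoc_mono (hMl ρ w) hCM ((min_le_right _ _).trans (min_le_right _ _)))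
  have hc2 : 0 ≤ SecondOrderResponse.cK2 d C Cs CM m := (hK2 0 0).nonneg (Sum.inl 0)
  set δ₀ : ℝ := min (m / 8) δΞ with hδ₀_def
  have hδ₀ : 0 < δ₀ := lt_min (by positivity) hδΞ
  refine ⟨SecondOrderResponse.cK2 d C Cs CM m + CΞ, δ₀, hδ₀, fun ν y' => ?_⟩
  exact biLoc_add (biLoc_mono (hK2 ν y') hc2 (min_le_left _ _)) (biLoc_mono (hΞ ν y') hCΞ (min_le_right _ _))

end Xi

end Summit.QuantumFields.BalabanUV.Beta.SecondOrderSeparationCalculus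

end
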